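import Mathlib
import Summits.Ventures.PercRepro.PuncturedLYMPeel

/-!
# PercRepro — THE VALUE-BLOCK (CAP) COMPOSITION LEMMA
(p10, gen 42)

Members `𝒞` (pairwise disjoint, all of size `m`) on a ground set `S`; a CAP `w` (`1 ≤ w < m`).  The cap instance at level `l`
has the rows `rowsCap S l 𝒞 w` = the `l`-subsets meeting every member in at most `w` points, and its columns are the capped
`(l+1)`-subsets (mass `a`); the BLOCK of a capped column `Y` is `blockOf 𝒞 w Y` = the members it meets in exactly `w`
points, with `rcount 𝒞 w Y` members and `blockPts 𝒞 w Y` = the `w·rcount` block points.  The composed weight `capWeight`: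
`0` on uncapped columns; `a·β(c)/(c·w)` from a capped column with block of size `c` to each row obtained by removing a
block point; otherwise the weight of the INNER flow of the block `B` — a flow of the cap-`(w−1)` instance on `S ∖ ⋃B` for
the members `𝒞 ∖ B` at level `l − w·#B`, with column masses `a·(1 − β #B)` on its capped columns and row sums
`R' #B − γ' #B · r_{w−1}`.  THEOREM `isFlow_capPeel` (PuncturedLYMCapPeelMain): with `γ' c = (m − w + 1)·a·β(c+1)/((c+1)·w)` and `R' c = R − γ·c`, the
composed weight is a flow of the cap-`w` instance with row sums `R − γ·r_w(X)` and column masses `a` on the capped columns —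
the composition step of the value-block peeling flow (paper proofs/P10-PEEL-g42.md §1b).  Nothing here asserts (SP).
-/

namespace PercRepro.PuncturedLYM.Split.Peel

open Finset

variable {α : Type} [DecidableEq α]

/-! ### Blocks, caps, rows -/

/-- The members met by `Z` in exactly `w` points. -/
def blockOf (𝒞 : Finset (Finset α)) (w : ℕ) (Z : Finset α) : Finset (Finset α) :=
  𝒞.filter (fun C => (Z ∩ C).card = w)

/-- The number of members met by `Z` in exactly `w` points. -/
def rcount (𝒞 : Finset (Finset α)) (w : ℕ) (Z : Finset α) : ℕ := (blockOf 𝒞 w Z).card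

/-- The union of a family of members. -/
def blockUnion (B : Finset (Finset α)) : Finset α := B.biUnion id

/-- The points of `Z` lying in its block members. -/
def blockPts (𝒞 : Finset (Finset α)) (w : ℕ) (Z : Finset α) : Finset α := Z ∩ blockUnion (blockOf 𝒞 w Z)

/-- The rows of the cap instance: the `l`-subsets of `S` meeting every member in at most `w` points. -/
def rowsCap (S : Finset α) (l : ℕ) (𝒞 : Finset (Finset α)) (w : ℕ) : Finset (Finset α) :=
  (S.powersetCard l).filter (fun X => ∀ C ∈ 𝒞, (X ∩ C).card ≤ w)

/-- The composed weight of the value-block peeling. -/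
def capWeight (𝒞 : Finset (Finset α)) (w : ℕ) (a : ℚ) (β : ℕ → ℚ)
    (w' : Finset (Finset α) → Finset α → Finset α → ℚ) (X Y : Finset α) : ℚ :=
  if ¬ (∀ C ∈ 𝒞, (Y ∩ C).card ≤ w) then 0
  else if ∃ y ∈ Y, y ∉ X ∧ y ∈ blockPts 𝒞 w Y then
    a * β (rcount 𝒞 w Y) / ((rcount 𝒞 w Y : ℚ) * w)
  else w' (blockOf 𝒞 w Y) (X \ blockUnion (blockOf 𝒞 w Y)) (Y \ blockUnion (blockOf 𝒞 w Y))

/-- Membership in the rows of the cap instance. -/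
theorem mem_rowsCap {S X : Finset α} {l w : ℕ} {𝒞 : Finset (Finset α)} :
    X ∈ rowsCap S l 𝒞 w ↔ X ⊆ S ∧ X.card = l ∧ ∀ C ∈ 𝒞, (X ∩ C).card ≤ w := by
  simp only [rowsCap, mem_filter, mem_powersetCard, and_assoc]

/-- Membership in a block. -/
theorem mem_blockOf {𝒞 : Finset (Finset α)} {w : ℕ} {Z C : Finset α} :
    C ∈ blockOf 𝒞 w Z ↔ C ∈ 𝒞 ∧ (Z ∩ C).card = w := by
  simp [blockOf]

/-- Membership in the union of a family. -/
theorem mem_blockUnion {B : Finset (Finset α)} {y : α} : y ∈ blockUnion B ↔ ∃ C ∈ B, y ∈ C := by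
  simp [blockUnion]

/-- Membership in the block points. -/
theorem mem_blockPts {𝒞 : Finset (Finset α)} {w : ℕ} {Z : Finset α} {y : α} :
    y ∈ blockPts 𝒞 w Z ↔ y ∈ Z ∧ ∃ C ∈ 𝒞, (Z ∩ C).card = w ∧ y ∈ C := by
  simp only [blockPts, mem_inter, mem_blockUnion, mem_blockOf]
  constructor
  · rintro ⟨hy, C, ⟨hC, hc⟩, hyC⟩; exact ⟨hy, C, hC, hc, hyC⟩
  · rintro ⟨hy, C, hC, hc, hyC⟩; exact ⟨hy, C, ⟨hC, hc⟩, hyC⟩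

/-- Removing a point that is not a block point of a capped set does not change its block. -/
theorem blockOf_erase_of_notMem_blockPts {𝒞 : Finset (Finset α)} {w : ℕ} {Y : Finset α}
    (hcap : ∀ C ∈ 𝒞, (Y ∩ C).card ≤ w) {y : α} (hy : y ∈ Y) (hyB : y ∉ blockPts 𝒞 w Y) :
    blockOf 𝒞 w (Y.erase y) = blockOf 𝒞 w Y := by
  ext C
  simp only [mem_blockOf]
  constructor
  · rintro ⟨hC, hc⟩
    refine ⟨hC, ?_⟩
    by_cases hyC : y ∈ C
    · rw [erase_inter, card_erase_of_mem (mem_inter.2 ⟨hy, hyC⟩)] at hc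
      have := hcap C hC
      omega
    · rw [erase_inter, erase_eq_of_notMem (fun h => hyC (mem_inter.1 h).2)] at hc
      exact hc
  · rintro ⟨hC, hc⟩
    refine ⟨hC, ?_⟩
    by_cases hyC : y ∈ C
    · exact absurd (mem_blockPts.2 ⟨hy, C, hC, hc, hyC⟩) hyB
    · rw [erase_inter, erase_eq_of_notMem (fun h => hyC (mem_inter.1 h).2)]
      exact hc

/-- The block points of a capped set number `w · rcount` (the block members are pairwise disjoint and each meets `Z`
in exactly `w` points). -/
theorem card_blockPts {𝒞 : Finset (Finset α)} (hdisj : ∀ C ∈ 𝒞, ∀ C' ∈ 𝒞, C ≠ C' → Disjoint C C') {w : ℕ}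
    {Z : Finset α} : (blockPts 𝒞 w Z).card = rcount 𝒞 w Z * w := by
  unfold blockPts blockUnion rcount
  rw [inter_biUnion, card_biUnion]
  · rw [sum_congr rfl (fun C hC => show (Z ∩ id C).card = w from (mem_blockOf.1 hC).2), sum_const, smul_eq_mul]
  · intro C hC C' hC' hne
    exact (hdisj C (mem_blockOf.1 hC).1 C' (mem_blockOf.1 hC').1 hne).mono inter_subset_right inter_subset_right

/-- A member outside the block of `Z` is disjoint from the block union. -/
theorem disjoint_blockUnion_of_notMem {𝒞 : Finset (Finset α)} (hdisj : ∀ C ∈ 𝒞, ∀ C' ∈ 𝒞, C ≠ C' → Disjoint C C')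
    {B : Finset (Finset α)} (hB : B ⊆ 𝒞) {C : Finset α} (hC : C ∈ 𝒞) (hCB : C ∉ B) : Disjoint C (blockUnion B) := by
  unfold blockUnion
  rw [disjoint_biUnion_right]
  intro C' hC'
  exact hdisj C hC C' (hB hC') (fun h => hCB (h ▸ hC'))

/-- A member outside the block meets `Z ∖ ⋃B` exactly where it meets `Z`. -/
theorem sdiff_blockUnion_inter_eq {𝒞 : Finset (Finset α)} (hdisj : ∀ C ∈ 𝒞, ∀ C' ∈ 𝒞, C ≠ C' → Disjoint C C')
    {B : Finset (Finset α)} (hB : B ⊆ 𝒞) {C : Finset α} (hC : C ∈ 𝒞) (hCB : C ∉ B) (Z : Finset α) :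
    (Z \ blockUnion B) ∩ C = Z ∩ C := by
  have hdC : Disjoint C (blockUnion B) := disjoint_blockUnion_of_notMem hdisj hB hC hCB
  ext z; simp only [mem_sdiff, mem_inter]
  constructor
  · rintro ⟨⟨hz, _⟩, hzC⟩; exact ⟨hz, hzC⟩
  · rintro ⟨hz, hzC⟩; exact ⟨⟨hz, fun hzU => (Finset.disjoint_left.1 hdC) hzC hzU⟩, hzC⟩

end PercRepro.PuncturedLYM.Split.Peel
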